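import Mathlib
import HarnessLib
import Summits.PneNP.PneNP.Theorems.AeaCutRectanglesTransversalEngine
import Summits.PneNP.PneNP.Theorems.AeaCutRectanglesDutyRectangles
import Summits.PneNP.PneNP.Theorems.AeaCutRectanglesClassCuts

/-!
# Crux `FoolingMeasure` (stmt-PneNP-19727) — p4 g8: UNIT-CRITICALITY, the SWAP WALL, the closed PARALLEL route,
# the REGISTER LEMMA and the QUARTER-IDLE WALL (kill side of the unit engine)

Companion to `Cruxes/FoolingMeasure/BarrierNotesP4g8.md`.  Continues `UnitFloor.lean` (p4 g5), `WitnessRankWall.lean`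
(p4 g6) and `ClosureAvalanche.lean` (p4 g7).  Everything concerns the HYPOTHESIS of the unit engine
`AeaCutRectanglesFixedCutFooling.foolingMeasure_of_spreadSystem` (frame `W`, units `π i` of two pairs, D1 = cover over
transversals, D2 = exactness witnesses, SPREAD over near-balanced cuts) — never `FoolingMeasure` itself.
HONEST FRAMING: elementary finite combinatorics and linear algebra over `ZMod 2`; FRONTIER restricted-model material
(AEA cut rectangles vs NON-3-COL); nothing here bears on P versus NP.

## Contents (all sorry-free)

§0 anatomy re-proved verbatim from p4 g5/g6 (crux workfiles are not importable): `unit_nonempty`, `not_isDiag_of_mem`,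
   `unit_mono_of_witness`, `witness_bichromatic`, `exists_witnesses`.
§1 UNIT-CRITICALITY (designs are born whole).  `tg_subfamily_subset_gammaMinus`, `subfamily_transversal_colorable`:
   in a D1 ∧ D2 system, EVERY transversal graph of EVERY proper subfamily of the units over EVERY sub-frame `W' ⊆ W` is
   3-colourable (it sits inside `Γ − π i₀` for a missing unit `i₀`, which D2 colours).  Hence `not_isUnitSystem_subfamily`:
   no proper subfamily (over any sub-frame) is itself a D1 ∧ D2 — or even a D1 — system.  Consequence for designs: a
   D1 ∧ D2 system can never be obtained by ADDING units (with or without extra frame edges) to a D1 system on the same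
   vertex set — "Toft + de-parallelising extra units", "glue two systems along a common frame", "augment a twin system by
   gadget units" are all void before any cut is examined (BarrierNotesP4g8 §1).
§2 THE SWAP WALL (perturbative designs are linear).  `parity_private_pairs_le`: over `ZMod 2`, vectors `x j : Fin n → ZMod 2`
   (`j < m`) and pairs `(u i, v i)` with `x j (u i) + x j (v i) = [j = i] + b i` for a unit-dependent offset `b i` force
   `m ≤ n + 1` (the differences `x j − x 0` are linearly independent: test a dependency against `x ↦ x (u i) + x (v i)`;
   the offsets cancel).  `swap_private_pairs_le`: if colourings `c j : Fin n → Fin 3` are all obtained from ONE base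
   colouring `c₀` by exchanging two fixed colours `a ≠ b` on a set `K j` (a Kempe-type swap, `K j` arbitrary), and carry
   private monochromatic pairs, then `m ≤ n + 1`.  `units_le_succ_of_swap_witnesses`: the same on the engine hypothesis —
   a D1 ∧ D2 system whose D2 witnesses form such a ONE-SWAP STAR FAMILY has at most `n + 1` units, so
   (`not_spread_of_swap_witnesses`, via the trivial floor `demand_le_units_of_spread`) the engine cannot fire on it for
   `n ≥ 16`.  `kempe_star_private_pairs_le` / `units_le_of_kempe_star_witnesses` / `not_spread_of_kempe_star_witnesses`:
   the same with the swap type (which two colours are exchanged) depending on the unit — every witness ONE Kempe-type swap,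
   of any type, on any vertex set, of one common base colouring — gives `m ≤ 3·(n + 1)` and no SPREAD for `n ≥ 256`.
   This closes, at the witness level, the "local repair / perturbation of one base colouring" door that the rank wall of
   p4 g6 does NOT see (swap families on arbitrary sets `K j` have full affine rank `n` over `ZMod 3`, where
   `private_pairs_le_rank` only gives `n² + n + 1`): BarrierNotesP4g8 §2.
§3 THE PARALLEL ROUTE TO `NoSpread`, TYPED — AND WHY IT IS CLOSED.  `ParallelOrLinear K ε`: every D1 ∧ D2 system with
   more than `K·n` units admits a class map with classes of size `≤ 2εn` under which both pairs of every unit meet the same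
   multiset of classes (the informal DICHOTOMY "superlinear ⇒ twin/parallel structure" of BarrierNotesP4g5 §3, typed).
   `splitUnits_eq_empty_of_parallel_classes` (F1 of p4 g4, verbatim) turns it into the window kill target of p4 g7
   (`linearOrZeroW_of_parallelOrLinear`), and `noSpread_of_parallelOrLinear` closes the chain
   `(∀ ε > 0, ∃ K, ParallelOrLinear K ε) ⇒ NoSpread` in the kernel.  STATUS OF THE HYPOTHESIS: REFUTED IN SKETCH by the
   CIRCUIT-COUPLED REGISTER DESIGNS of BarrierNotesP4g8 §4 (three registers of size `N`, a palette triangle, and `O(N)` gadget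
   vertices computing a torus shear; `m = N²` units on `n = Θ(N)` vertices, D1 ∧ D2, and — this part IS checked, §5 below —
   not class-parallel at any scale `< N + 1`).  So superlinearity does NOT force class-parallel structure; those designs die
   instead by the bipartite-`D` zero cut ((3a) of p4 g3), and the kill target of X1 stays the CUT-theoretic `LinearOrZeroW`
   of p4 g7 (which they satisfy).  The typed predicate and the chain are kept as the record of exactly which structural
   invariant is NOT the obstruction.
§4 THE REGISTER LEMMA.  `register_oneHot` / `witness_oneHot`: on a complete bipartite duo pattern `X × Y` (every pair `{x, y}`
   a unit pair, as in Toft's system) three colours force every D2 witness to be ONE-HOT on both registers (constant off the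
   special index on each side, three distinct colours).  Checked core of the coupling analysis of BarrierNotesP4g8 §3: on such
   patterns a witness carries exactly "which index is special", and the frame's only job is to transport that index to the
   second pairs — vertex-by-vertex (twins: parallel) or through a computation (§4 of the memo: linear-size circuits suffice).
§5 THE TORUS-SHEAR PATTERN IS NOT CLASS-PARALLEL.  `shear_parallel_identifies`, `shear_parallel_big_class`,
   `not_small_parallel_of_shear`: for units `(x, y) ↦ {s(bx x, by y), s(bx' (x + y), by y)}` (`x, y ∈ Fin N`, addition in
   `Fin N`), every class map making all units parallel puts `bx 0` and all of `bx' (Fin N)` into one class (size `≥ N + 1`), so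
   the conclusion of `ParallelOrLinear` fails for any unit family containing the pattern once `2εn < N + 1`.
§6 THE QUARTER-IDLE WALL.  `splitUnits_subset_of_class_idle`: a colour class of a D2 witness of unit `i`, padded with idle
   (pair-free) vertices, has no unit pair inside except possibly `i`'s.  `exists_nearBisection_splitUnits_le_one`: if
   `|idle| ≥ n/4 + 2`, an exact near-bisection splits at most one unit; `not_spread_of_quarter_idle`: then no SPREAD
   (`n ≥ 4`).  This halves the idle-half wall of p4 g6 (`|idle| ≥ n/2`) and is the budget inequality every gadget / circuit
   frame must meet: auxiliary vertices < a quarter of all vertices, and every witness colour class < `(1/2 − ε)n − |idle|`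
   (BarrierNotesP4g8 §5).
-/

set_option linter.dupNamespace false

namespace Summit.PneNP.PneNP.Cruxes.FoolingMeasure.P4g8

open Finset
open Summit.PneNP.PneNP.Theorems.AeaCutRectanglesTransversalEngine
open Summit.PneNP.PneNP.Theorems.AeaCutRectanglesDutyRectangles
open Summit.PneNP.PneNP.Theorems.AeaCutRectanglesClassCuts

/-- A D1 ∧ D2 UNIT SYSTEM on `Fin n` with `m` units: verbatim the first three conjuncts of the hypothesis of
`foolingMeasure_of_spreadSystem` (and verbatim `P4g4/P4g5/P4g6/P4g7.IsUnitSystem`; crux workfiles are not importable,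
so the text is repeated). -/
def IsUnitSystem (n m : ℕ) (W : Finset (Sym2 (Fin n))) (π : Fin m → Finset (Sym2 (Fin n))) : Prop :=
  (∀ i, (π i).card = 2) ∧
  (∀ t : Fin m → Sym2 (Fin n), (∀ i, t i ∈ π i) →
    (∀ e ∈ tg W t, ¬ e.IsDiag) ∧ ¬ (SimpleGraph.fromEdgeSet (↑(tg W t) : Set (Sym2 (Fin n)))).Colorable 3) ∧
  (∀ i, (SimpleGraph.fromEdgeSet (↑(gammaMinus W π i) : Set (Sym2 (Fin n)))).Colorable 3)

variable {n m : ℕ} {W : Finset (Sym2 (Fin n))} {π : Fin m → Finset (Sym2 (Fin n))}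

/-! ## §0  Anatomy (re-proved verbatim from `UnitFloor.lean` / `WitnessRankWall.lean`) -/

theorem unit_nonempty (hsys : IsUnitSystem n m W π) (i : Fin m) : (π i).Nonempty :=
  card_pos.1 (by rw [hsys.1 i]; norm_num)

/-- Every unit pair is loopless. -/
theorem not_isDiag_of_mem (hsys : IsUnitSystem n m W π) {i : Fin m} {e : Sym2 (Fin n)} (he : e ∈ π i) :
    ¬ e.IsDiag := by
  classical
  let t : Fin m → Sym2 (Fin n) := fun j => if j = i then e else (unit_nonempty hsys j).choose
  have ht : ∀ j, t j ∈ π j := by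
    intro j
    by_cases hj : j = i
    · subst hj; simp [t, he]
    · simp [t, hj, (unit_nonempty hsys j).choose_spec]
  have h := (hsys.2.1 t ht).1 (t i) (mem_tg.2 (Or.inr ⟨i, rfl⟩))
  simpa [t] using h

/-- In a D1 ∧ D2 system every D2 witness of unit `i` makes BOTH pairs of unit `i` monochromatic. -/
theorem unit_mono_of_witness (hsys : IsUnitSystem n m W π) {i : Fin m} {c : Fin n → Fin 3}
    (hc : c ∉ killSet (gammaMinus W π i)) {e : Sym2 (Fin n)} (he : e ∈ π i) : (e.map c).IsDiag := by
  classical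
  let t : Fin m → Sym2 (Fin n) := fun j => if j = i then e else (unit_nonempty hsys j).choose
  have ht : ∀ j, t j ∈ π j := by
    intro j
    by_cases hj : j = i
    · subst hj; simp [t, he]
    · simp [t, hj, (unit_nonempty hsys j).choose_spec]
  obtain ⟨-, hnc⟩ := hsys.2.1 t ht
  obtain ⟨e', he', hd', hm'⟩ := (not_colorable_iff_forall_mem_killSet _).1 hnc c
  rcases mem_tg.1 he' with hW | ⟨j, rfl⟩
  · exact absurd ⟨e', mem_gammaMinus.2 (Or.inl hW), hd', hm'⟩ hc
  · by_cases hj : j = i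
    · subst hj; simpa [t] using hm'
    · exact absurd ⟨t j, mem_gammaMinus.2 (Or.inr ⟨j, hj, ht j⟩), hd', hm'⟩ hc

/-- A D2 witness of unit `j` is bichromatic on every pair of every other unit. -/
theorem witness_bichromatic (hsys : IsUnitSystem n m W π) {i j : Fin m} (hij : i ≠ j) {c : Fin n → Fin 3}
    (hc : c ∉ killSet (gammaMinus W π j)) {a b : Fin n} (hab : s(a, b) ∈ π i) : c a ≠ c b := by
  intro h
  exact hc ⟨s(a, b), mem_gammaMinus.2 (Or.inr ⟨i, hij, hab⟩), not_isDiag_of_mem hsys hab,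
    (map_mk_isDiag_iff c a b).2 h⟩

/-- D2 witnesses exist: one proper colouring of `Γ − πᵢ` per unit. -/
theorem exists_witnesses (hsys : IsUnitSystem n m W π) :
    ∃ c : Fin m → Fin n → Fin 3, ∀ i, c i ∉ killSet (gammaMinus W π i) := by
  have h : ∀ i, ∃ c : Fin n → Fin 3, c ∉ killSet (gammaMinus W π i) :=
    fun i => (colorable_iff_exists_not_mem_killSet _).1 (hsys.2.2 i)
  choose c hc using h
  exact ⟨c, hc⟩

/-! ## §1  Unit-criticality: no proper subfamily is a D1 system -/

/-- A transversal graph of a subfamily `π ∘ e` that misses unit `i₀`, over a sub-frame `W' ⊆ W`, lies inside `Γ − π i₀`. -/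
theorem tg_subfamily_subset_gammaMinus {W' : Finset (Sym2 (Fin n))} (hW' : W' ⊆ W) {i₀ : Fin m} {m' : ℕ}
    {e : Fin m' → Fin m} (he : ∀ j, e j ≠ i₀) {t' : Fin m' → Sym2 (Fin n)} (ht' : ∀ j, t' j ∈ π (e j)) :
    tg W' t' ⊆ gammaMinus W π i₀ := by
  intro x hx
  rcases mem_tg.1 hx with hW | ⟨j, rfl⟩
  · exact mem_gammaMinus.2 (Or.inl (hW' hW))
  · exact mem_gammaMinus.2 (Or.inr ⟨e j, he j, ht' j⟩)

/-- **UNIT-CRITICALITY.**  In a D1 ∧ D2 system, every transversal graph of every subfamily of the units that misses some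
unit `i₀`, over every sub-frame `W' ⊆ W`, is 3-colourable (D2 for `i₀`). -/
theorem subfamily_transversal_colorable (hsys : IsUnitSystem n m W π) {W' : Finset (Sym2 (Fin n))} (hW' : W' ⊆ W)
    {i₀ : Fin m} {m' : ℕ} {e : Fin m' → Fin m} (he : ∀ j, e j ≠ i₀) {t' : Fin m' → Sym2 (Fin n)}
    (ht' : ∀ j, t' j ∈ π (e j)) :
    (SimpleGraph.fromEdgeSet (↑(tg W' t') : Set (Sym2 (Fin n)))).Colorable 3 := by
  refine (hsys.2.2 i₀).mono_left (SimpleGraph.fromEdgeSet_mono ?_)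
  exact coe_subset.2 (tg_subfamily_subset_gammaMinus hW' he ht')

/-- **No proper subfamily of a D1 ∧ D2 system is a D1 ∧ D2 system** (over any sub-frame): the subfamily has a
transversal, and its transversal graph is 3-colourable by `subfamily_transversal_colorable`, contradicting D1 of the
subfamily.  ("Designs are born whole": one cannot add units to a D1 system and keep D2.) -/
theorem not_isUnitSystem_subfamily (hsys : IsUnitSystem n m W π) {W' : Finset (Sym2 (Fin n))} (hW' : W' ⊆ W)
    {m' : ℕ} {e : Fin m' → Fin m} {i₀ : Fin m} (he : ∀ j, e j ≠ i₀) :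
    ¬ IsUnitSystem n m' W' (π ∘ e) := by
  intro hsub
  let t' : Fin m' → Sym2 (Fin n) := fun j => (unit_nonempty hsys (e j)).choose
  have ht' : ∀ j, t' j ∈ π (e j) := fun j => (unit_nonempty hsys (e j)).choose_spec
  exact (hsub.2.1 t' ht').2 (subfamily_transversal_colorable hsys hW' he ht')

/-- The same with only the D1 clause of the subfamily as hypothesis (D1 alone already fails for proper subfamilies). -/
theorem subfamily_not_D1 (hsys : IsUnitSystem n m W π) {W' : Finset (Sym2 (Fin n))} (hW' : W' ⊆ W)
    {m' : ℕ} {e : Fin m' → Fin m} {i₀ : Fin m} (he : ∀ j, e j ≠ i₀) :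
    ¬ (∀ t' : Fin m' → Sym2 (Fin n), (∀ j, t' j ∈ π (e j)) →
        ¬ (SimpleGraph.fromEdgeSet (↑(tg W' t') : Set (Sym2 (Fin n)))).Colorable 3) := by
  intro hD1
  let t' : Fin m' → Sym2 (Fin n) := fun j => (unit_nonempty hsys (e j)).choose
  have ht' : ∀ j, t' j ∈ π (e j) := fun j => (unit_nonempty hsys (e j)).choose_spec
  exact hD1 t' ht' (subfamily_transversal_colorable hsys hW' he ht')

/-! ## §2  The swap wall: one-swap star families of witnesses are linear -/

/-- **Parity lemma.**  Vectors `x j : Fin n → ZMod 2` (`j < m`) and pairs `(u i, v i)` such that the parity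
`x j (u i) + x j (v i)` equals `[j = i] + b i` for an offset `b i` depending only on the unit: then `m ≤ n + 1`
(the `m − 1` differences `x j − x 0` are linearly independent). -/
theorem parity_private_pairs_le {n m : ℕ} (x : Fin m → Fin n → ZMod 2) (u v : Fin m → Fin n) (b : Fin m → ZMod 2)
    (h : ∀ i j, x j (u i) + x j (v i) = (if j = i then 1 else 0) + b i) : m ≤ n + 1 := by
  have h01 : ∀ z : ZMod 2, z = 0 ∨ z = 1 := by decide
  cases m with
  | zero => omega
  | succ m' =>
    suffices hli : LinearIndependent (ZMod 2) (fun j : Fin m' => x j.succ + x 0) by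
      have := hli.fintype_card_le_finrank
      simp only [Fintype.card_fin, Module.finrank_fintype_fun_eq_card] at this
      omega
    rw [Fintype.linearIndependent_iff]
    intro g hg k
    have h1 := congrFun hg (u k.succ)
    have h2 := congrFun hg (v k.succ)
    simp only [Finset.sum_apply, Pi.smul_apply, Pi.add_apply, smul_eq_mul, Pi.zero_apply] at h1 h2
    have hx : ∀ j : Fin m', (x j.succ (u k.succ) + x 0 (u k.succ)) + (x j.succ (v k.succ) + x 0 (v k.succ))
        = if j = k then 1 else 0 := by
      intro j
      have e1 := h k.succ j.succ
      have e0 := h k.succ 0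
      rw [if_neg (Fin.succ_ne_zero k).symm] at e0
      have hrw : (x j.succ (u k.succ) + x 0 (u k.succ)) + (x j.succ (v k.succ) + x 0 (v k.succ))
          = (x j.succ (u k.succ) + x j.succ (v k.succ)) + (x 0 (u k.succ) + x 0 (v k.succ)) := by ring
      rw [hrw, e1, e0]
      by_cases hjk : j = k
      · subst hjk
        rw [if_pos rfl, if_pos rfl]
        rcases h01 (b j.succ) with hb | hb <;> rw [hb] <;> decide
      · rw [if_neg hjk, if_neg (fun h' => hjk (Fin.succ_inj.1 h'))]
        rcases h01 (b k.succ) with hb | hb <;> rw [hb] <;> decide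
    have hsum : ∑ j : Fin m', g j * (if j = k then 1 else 0) = 0 := by
      calc ∑ j : Fin m', g j * (if j = k then 1 else 0)
          = ∑ j : Fin m', (g j * (x j.succ (u k.succ) + x 0 (u k.succ)) +
              g j * (x j.succ (v k.succ) + x 0 (v k.succ))) := by
            refine sum_congr rfl fun j _ => ?_
            rw [← hx j]; ring
        _ = 0 := by rw [sum_add_distrib, h1, h2, add_zero]
    simpa [Finset.sum_ite_eq'] using hsum

/-- Case table for one swap: for `p, q ∈ {a, b}`, swapping `a ↔ b` on a sub-selection of `{p, q}` leaves them equal iff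
(both or neither swapped) ↔ (they were equal). -/
theorem swapIf_eq_iff {a b p q : Fin 3} (hab : a ≠ b) (hp : p = a ∨ p = b) (hq : q = a ∨ q = b)
    (P Q : Prop) [Decidable P] [Decidable Q] :
    ((if P then Equiv.swap a b p else p) = (if Q then Equiv.swap a b q else q)) ↔ ((P ↔ Q) ↔ p = q) := by
  rcases hp with rfl | rfl <;> rcases hq with rfl | rfl <;> by_cases hP : P <;> by_cases hQ : Q <;>
    simp [hP, hQ, Equiv.swap_apply_left, Equiv.swap_apply_right, hab, hab.symm]

/-- **SWAP WALL (colour level).**  Colourings `c j` (`j < m`, `m ≥ 2`) all obtained from ONE base colouring `c₀` by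
exchanging the colours `a ≠ b` on a set `K j`, with private monochromatic pairs (`c i` mono on pair `i`, every other
`c j` bichromatic on pair `i`): then `m ≤ n + 1`. -/
theorem swap_private_pairs_le (c₀ : Fin n → Fin 3) {a b : Fin 3} (hab : a ≠ b) (K : Fin m → Finset (Fin n))
    (c : Fin m → Fin n → Fin 3) (hK : ∀ j w, c j w = if w ∈ K j then Equiv.swap a b (c₀ w) else c₀ w)
    (u v : Fin m → Fin n) (hmono : ∀ i, c i (u i) = c i (v i)) (hbi : ∀ i j, j ≠ i → c j (u i) ≠ c j (v i))
    (hm : 2 ≤ m) : m ≤ n + 1 := by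
  classical
  -- some index other than `i`
  have hother : ∀ i : Fin m, ∃ j : Fin m, j ≠ i := by
    intro i
    by_cases hi : (i : ℕ) = 0
    · exact ⟨⟨1, by omega⟩, fun h => by simp [Fin.ext_iff, hi] at h⟩
    · exact ⟨⟨0, by omega⟩, fun h => hi (by rw [← h])⟩
  -- a colour outside `{a, b}` is fixed by every `c j`
  have hfix : ∀ j w, c₀ w ≠ a → c₀ w ≠ b → c j w = c₀ w := by
    intro j w ha hb
    rw [hK]
    split_ifs
    · exact Equiv.swap_apply_of_ne_of_ne ha hb
    · rfl
  -- both endpoints of every private pair carry base colours in `{a, b}`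
  have hmem : ∀ i, (c₀ (u i) = a ∨ c₀ (u i) = b) ∧ (c₀ (v i) = a ∨ c₀ (v i) = b) := by
    intro i
    obtain ⟨j, hj⟩ := hother i
    have swap_inv : ∀ p q : Fin 3, p ≠ a → p ≠ b →
        ((if True then Equiv.swap a b q else q) = p ∨ q = p) → q = p := by
      intro p q hpa hpb h
      rcases h with h | h
      · rw [if_pos trivial] at h
        have := congrArg (Equiv.swap a b) h
        rw [Equiv.swap_apply_self, Equiv.swap_apply_of_ne_of_ne hpa hpb] at this
        exact this
      · exact h
    by_contra hcon
    rw [not_and_or, not_or, not_or] at hcon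
    rcases hcon with ⟨hua, hub⟩ | ⟨hva, hvb⟩
    · -- `u i` is fixed; then `v i` has the same base colour, and pair `i` is mono under `c j`, `j ≠ i`
      have hu : ∀ j', c j' (u i) = c₀ (u i) := fun j' => hfix j' (u i) hua hub
      have hv0 : c₀ (v i) = c₀ (u i) := by
        have e := hmono i
        rw [hu i, hK i (v i)] at e
        by_cases hvK : v i ∈ K i
        · rw [if_pos hvK] at e
          have := congrArg (Equiv.swap a b) e.symm
          rw [Equiv.swap_apply_self, Equiv.swap_apply_of_ne_of_ne hua hub] at this
          exact this
        · rw [if_neg hvK] at e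
          exact e.symm
      have hv : c j (v i) = c₀ (v i) := hfix j (v i) (hv0 ▸ hua) (hv0 ▸ hub)
      exact hbi i j hj (by rw [hu j, hv, hv0])
    · have hv : ∀ j', c j' (v i) = c₀ (v i) := fun j' => hfix j' (v i) hva hvb
      have hu0 : c₀ (u i) = c₀ (v i) := by
        have e := hmono i
        rw [hv i, hK i (u i)] at e
        by_cases huK : u i ∈ K i
        · rw [if_pos huK] at e
          have := congrArg (Equiv.swap a b) e
          rw [Equiv.swap_apply_self, Equiv.swap_apply_of_ne_of_ne hva hvb] at this
          exact this
        · rw [if_neg huK] at e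
          exact e
      have hu : c j (u i) = c₀ (u i) := hfix j (u i) (hu0 ▸ hva) (hu0 ▸ hvb)
      exact hbi i j hj (by rw [hv j, hu, hu0])
  -- parity bookkeeping
  have h11 : (1 : ZMod 2) + 1 = 0 := by decide
  let x : Fin m → Fin n → ZMod 2 := fun j w => if w ∈ K j then 1 else 0
  let d : Fin m → ZMod 2 := fun i => if c₀ (u i) = c₀ (v i) then 0 else 1
  have factA : ∀ i j, (c j (u i) = c j (v i) ↔ x j (u i) + x j (v i) = d i) := by
    intro i j
    obtain ⟨hp, hq⟩ := hmem i
    rw [hK j (u i), hK j (v i), swapIf_eq_iff hab hp hq]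
    rcases hp with hp | hp <;> rcases hq with hq | hq <;> by_cases hu : u i ∈ K j <;> by_cases hv : v i ∈ K j <;>
      simp [x, d, hp, hq, hu, hv, hab, hab.symm, h11]
  refine parity_private_pairs_le x u v (fun i => d i + 1) ?_
  intro i j
  have h01 : ∀ z : ZMod 2, z = 0 ∨ z = 1 := by decide
  by_cases hji : j = i
  · subst hji
    rw [if_pos rfl, (factA j j).1 (hmono j)]
    rcases h01 (d j) with h | h <;> rw [h] <;> decide
  · rw [if_neg hji]
    have hne : x j (u i) + x j (v i) ≠ d i := fun h => hbi i j hji ((factA i j).2 h)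
    rcases h01 (d i) with h | h <;> rcases h01 (x j (u i) + x j (v i)) with h' | h' <;>
      simp only [h, h'] at hne ⊢ <;> first | decide | exact (hne rfl).elim

/-- **SWAP WALL on the engine hypothesis.**  If a D1 ∧ D2 unit system admits D2 witnesses that are all obtained from one
base colouring `c₀` by exchanging two fixed colours `a ≠ b` on sets `K j` (one Kempe-type swap each, `K j` arbitrary),
then `m ≤ n + 1`. -/
theorem units_le_succ_of_swap_witnesses (hsys : IsUnitSystem n m W π)
    (c : Fin m → Fin n → Fin 3) (hc : ∀ i, c i ∉ killSet (gammaMinus W π i))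
    (c₀ : Fin n → Fin 3) {a b : Fin 3} (hab : a ≠ b) (K : Fin m → Finset (Fin n))
    (hK : ∀ j w, c j w = if w ∈ K j then Equiv.swap a b (c₀ w) else c₀ w) : m ≤ n + 1 := by
  classical
  by_cases hm : m ≤ 1
  · omega
  push Not at hm
  have hpair : ∀ i, ∃ p : Fin n × Fin n, s(p.1, p.2) ∈ π i := by
    intro i
    obtain ⟨e, he⟩ := unit_nonempty hsys i
    induction e using Sym2.ind with
    | h a b => exact ⟨(a, b), he⟩
  choose p hp using hpair
  refine swap_private_pairs_le c₀ hab K c hK (fun i => (p i).1) (fun i => (p i).2) ?_ ?_ hm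
  · intro i
    exact (map_mk_isDiag_iff (c i) _ _).1 (unit_mono_of_witness hsys (hc i) (hp i))
  · intro i j hji
    exact witness_bichromatic hsys (Ne.symm hji) (hc j) (hp i)

/-- **KEMPE STAR FAMILIES (three swap types).**  Colourings `c j` each obtained from ONE base colouring `c₀` by ONE
Kempe-type swap — exchanging the two colours other than `f j` on an arbitrary set `K j`, the fixed colour `f j` depending
on `j` — with private monochromatic pairs: then `m ≤ 3·(n + 1)` (sort the units by swap type and apply
`swap_private_pairs_le` to each type). -/
theorem kempe_star_private_pairs_le (c₀ : Fin n → Fin 3) (f : Fin m → Fin 3) (K : Fin m → Finset (Fin n))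
    (c : Fin m → Fin n → Fin 3)
    (hK : ∀ j w, c j w = if w ∈ K j then Equiv.swap (f j + 1) (f j + 2) (c₀ w) else c₀ w)
    (u v : Fin m → Fin n) (hmono : ∀ i, c i (u i) = c i (v i)) (hbi : ∀ i j, j ≠ i → c j (u i) ≠ c j (v i)) :
    m ≤ 3 * (n + 1) := by
  classical
  have h12 : ∀ t : Fin 3, t + 1 ≠ t + 2 := by decide
  have hcls : ∀ t : Fin 3, (univ.filter fun j => f j = t).card ≤ n + 1 := by
    intro t
    by_cases hk1 : (univ.filter fun j => f j = t).card ≤ 1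
    · omega
    push Not at hk1
    let ι : Fin (univ.filter fun j => f j = t).card ↪o Fin m := (univ.filter fun j => f j = t).orderEmbOfFin rfl
    have hι : ∀ i, ι i ∈ (univ.filter fun j => f j = t) := fun i => Finset.orderEmbOfFin_mem _ rfl i
    have hf : ∀ i, f (ι i) = t := fun i => (mem_filter.1 (hι i)).2
    refine swap_private_pairs_le c₀ (h12 t) (fun i => K (ι i)) (fun i => c (ι i)) ?_
      (fun i => u (ι i)) (fun i => v (ι i)) ?_ ?_ hk1
    · intro j w
      rw [hK, hf]
    · intro i
      exact hmono (ι i)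
    · intro i j hji
      exact hbi (ι i) (ι j) (fun h => hji (ι.injective h))
  have hsum : m = ∑ t : Fin 3, (univ.filter fun j => f j = t).card := by
    rw [← card_eq_sum_card_fiberwise (fun j _ => mem_univ (f j)), card_univ, Fintype.card_fin]
  calc m = ∑ t : Fin 3, (univ.filter fun j => f j = t).card := hsum
    _ ≤ ∑ _t : Fin 3, (n + 1) := sum_le_sum fun t _ => hcls t
    _ = 3 * (n + 1) := by simp

/-- **KEMPE STAR WALL on the engine hypothesis.**  If a D1 ∧ D2 unit system admits D2 witnesses each of which is ONE
Kempe-type swap (two colours exchanged on an arbitrary vertex set, the swap type depending on the unit) of one common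
base colouring `c₀`, then `m ≤ 3·(n + 1)`. -/
theorem units_le_of_kempe_star_witnesses (hsys : IsUnitSystem n m W π)
    (c : Fin m → Fin n → Fin 3) (hc : ∀ i, c i ∉ killSet (gammaMinus W π i))
    (c₀ : Fin n → Fin 3) (f : Fin m → Fin 3) (K : Fin m → Finset (Fin n))
    (hK : ∀ j w, c j w = if w ∈ K j then Equiv.swap (f j + 1) (f j + 2) (c₀ w) else c₀ w) :
    m ≤ 3 * (n + 1) := by
  classical
  have hpair : ∀ i, ∃ p : Fin n × Fin n, s(p.1, p.2) ∈ π i := by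
    intro i
    obtain ⟨e, he⟩ := unit_nonempty hsys i
    induction e using Sym2.ind with
    | h a b => exact ⟨(a, b), he⟩
  choose p hp using hpair
  refine kempe_star_private_pairs_le c₀ f K c hK (fun i => (p i).1) (fun i => (p i).2) ?_ ?_
  · intro i
    exact (map_mk_isDiag_iff (c i) _ _).1 (unit_mono_of_witness hsys (hc i) (hp i))
  · intro i j hji
    exact witness_bichromatic hsys (Ne.symm hji) (hc j) (hp i)

/-- The SPREAD clause of the engine hypothesis (verbatim `P4g5.Spread`). -/
def Spread (ε T : ℝ) (π : Fin m → Finset (Sym2 (Fin n))) : Prop :=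
  ∀ B : Finset (Fin n), (1 / 2 - ε) * (n : ℝ) ≤ B.card → (B.card : ℝ) ≤ (1 / 2 + ε) * n →
    ∃ I : Finset (Fin m), T ≤ I.card ∧ ∀ i ∈ I, (∃ e ∈ π i, ∀ v ∈ e, v ∈ B) ∧ (∃ e ∈ π i, ∃ v ∈ e, v ∉ B)

/-- Trivial floor: once the window contains a near-bisection (`2εn ≥ 1`), the demand is at most the number of units. -/
theorem demand_le_units_of_spread {ε T : ℝ} (hεn : 1 ≤ 2 * ε * n) (h : Spread ε T π) : T ≤ m := by
  classical
  obtain ⟨B, -, hBcard⟩ := exists_subset_card_eq (s := (univ : Finset (Fin n))) (n := (n + 1) / 2)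
    (by rw [card_univ, Fintype.card_fin]; omega)
  have h1 : (n : ℝ) ≤ 2 * (B.card : ℝ) + 1 := by exact_mod_cast (by omega : n ≤ 2 * B.card + 1)
  have h2 : 2 * (B.card : ℝ) ≤ n + 1 := by exact_mod_cast (by omega : 2 * B.card ≤ n + 1)
  have hn : (0 : ℝ) ≤ n := Nat.cast_nonneg n
  obtain ⟨I, hT, -⟩ := h B (by nlinarith) (by nlinarith)
  refine hT.trans ?_
  exact_mod_cast (card_le_univ I).trans (by rw [Fintype.card_fin])

/-- **The engine cannot fire on a one-swap star family** (`n ≥ 16`): `m ≤ n + 1 < 2n ≤ (n/2)·log₂ n + C·n`. -/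
theorem not_spread_of_swap_witnesses (hsys : IsUnitSystem n m W π)
    (c : Fin m → Fin n → Fin 3) (hc : ∀ i, c i ∉ killSet (gammaMinus W π i))
    (c₀ : Fin n → Fin 3) {a b : Fin 3} (hab : a ≠ b) (K : Fin m → Finset (Fin n))
    (hK : ∀ j w, c j w = if w ∈ K j then Equiv.swap a b (c₀ w) else c₀ w)
    {ε : ℝ} {C : ℕ} (hn : 16 ≤ n) (hεn : 1 ≤ 2 * ε * n) :
    ¬ Spread ε ((n : ℝ) / 2 * Real.logb 2 n + (C : ℝ) * n) π := by
  intro h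
  have hm : (m : ℝ) ≤ n + 1 := by exact_mod_cast units_le_succ_of_swap_witnesses hsys c hc c₀ hab K hK
  have hT := demand_le_units_of_spread hεn h
  have hn' : (16 : ℝ) ≤ n := by exact_mod_cast hn
  have hlog : (4 : ℝ) ≤ Real.logb 2 n := by
    rw [Real.le_logb_iff_rpow_le (by norm_num) (by linarith)]
    have : (2 : ℝ) ^ (4 : ℝ) = 16 := by
      rw [show (4 : ℝ) = ((4 : ℕ) : ℝ) by norm_num, Real.rpow_natCast]
      norm_num
    rw [this]
    exact hn'
  have hC : (0 : ℝ) ≤ (C : ℝ) * n := by positivity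
  have h2n : 2 * (n : ℝ) ≤ (n : ℝ) / 2 * Real.logb 2 n := by nlinarith
  linarith

/-- **The engine cannot fire on a Kempe star family** (three swap types, `n ≥ 256`):
`m ≤ 3n + 3 < 4n ≤ (n/2)·log₂ n + C·n`. -/
theorem not_spread_of_kempe_star_witnesses (hsys : IsUnitSystem n m W π)
    (c : Fin m → Fin n → Fin 3) (hc : ∀ i, c i ∉ killSet (gammaMinus W π i))
    (c₀ : Fin n → Fin 3) (f : Fin m → Fin 3) (K : Fin m → Finset (Fin n))
    (hK : ∀ j w, c j w = if w ∈ K j then Equiv.swap (f j + 1) (f j + 2) (c₀ w) else c₀ w)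
    {ε : ℝ} {C : ℕ} (hn : 256 ≤ n) (hεn : 1 ≤ 2 * ε * n) :
    ¬ Spread ε ((n : ℝ) / 2 * Real.logb 2 n + (C : ℝ) * n) π := by
  intro h
  have hm : (m : ℝ) ≤ 3 * (n + 1) := by exact_mod_cast units_le_of_kempe_star_witnesses hsys c hc c₀ f K hK
  have hT := demand_le_units_of_spread hεn h
  have hn' : (256 : ℝ) ≤ n := by exact_mod_cast hn
  have hlog : (8 : ℝ) ≤ Real.logb 2 n := by
    rw [Real.le_logb_iff_rpow_le (by norm_num) (by linarith)]
    have : (2 : ℝ) ^ (8 : ℝ) = 256 := by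
      rw [show (8 : ℝ) = ((8 : ℕ) : ℝ) by norm_num, Real.rpow_natCast]
      norm_num
    rw [this]
    exact hn'
  have hC : (0 : ℝ) ≤ (C : ℝ) * n := by positivity
  have h4n : 4 * (n : ℝ) ≤ (n : ℝ) / 2 * Real.logb 2 n := by nlinarith
  linarith

/-! ## §3  The parallel route to `NoSpread`: `ParallelOrLinear` typed, reduced to the window kill target — and closed

The chain below is valid; its hypothesis `∀ ε > 0, ∃ K, ParallelOrLinear K ε` is refuted in sketch by the circuit-coupled
register designs of BarrierNotesP4g8 §4 (pattern-level non-parallelism checked in §5).  Kept as the typed record that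
class-parallelism is not what superlinearity forces; the cut-theoretic `LinearOrZeroW` (p4 g7) is unaffected. -/

/-- **(F1) Parallel-class kill** (verbatim `P4g4.splitUnits_eq_empty_of_parallel_classes`, restated because crux workfiles
are not importable).  If the classes of `cls` have size `≤ 2εn` and both pairs of every unit meet the same multiset of
classes, some union of classes is a cut in the `ε`-window splitting no unit. -/
theorem splitUnits_eq_empty_of_parallel_classes {n m k : ℕ} (ε : ℝ) (hε : 0 < ε)
    (π : Fin m → Finset (Sym2 (Fin n))) (cls : Fin n → Fin k)
    (hsmall : ∀ a : Fin k, ((univ.filter fun v => cls v = a).card : ℝ) ≤ 2 * ε * n)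
    (hpar : ∀ i, ∀ e ∈ π i, ∀ e' ∈ π i, e.map cls = e'.map cls) :
    ∃ A : Finset (Fin k),
      (1 / 2 - ε) * (n : ℝ) ≤ (univ.filter fun v => cls v ∈ A).card ∧
      ((univ.filter fun v => cls v ∈ A).card : ℝ) ≤ (1 / 2 + ε) * n ∧
      splitUnits π (univ.filter fun v => cls v ∈ A) = ∅ := by
  classical
  set f : ℕ → ℕ := fun j => (univ.filter fun v : Fin n => (cls v : ℕ) < j).card with hf
  have hf0 : f 0 = 0 := by simp [hf]
  have hfk : f k = n := by
    have h : (univ.filter fun v : Fin n => (cls v : ℕ) < k) = univ :=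
      filter_true_of_mem fun v _ => (cls v).is_lt
    simp only [hf]
    rw [h, card_univ, Fintype.card_fin]
  have hstep : ∀ j, (f (j + 1) : ℝ) ≤ f j + 2 * ε * n := by
    intro j
    have hsplit : (univ.filter fun v : Fin n => (cls v : ℕ) < j + 1) =
        (univ.filter fun v : Fin n => (cls v : ℕ) < j) ∪ (univ.filter fun v : Fin n => (cls v : ℕ) = j) := by
      ext v
      simp only [mem_filter, mem_union, mem_univ, true_and]
      omega
    have hdisj : Disjoint (univ.filter fun v : Fin n => (cls v : ℕ) < j)
        (univ.filter fun v : Fin n => (cls v : ℕ) = j) := by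
      rw [disjoint_filter]
      intro v _ h1 h2
      omega
    have hcls : (((univ.filter fun v : Fin n => (cls v : ℕ) = j)).card : ℝ) ≤ 2 * ε * n := by
      by_cases hj : j < k
      · have h : (univ.filter fun v : Fin n => (cls v : ℕ) = j) = (univ.filter fun v => cls v = ⟨j, hj⟩) := by
          ext v
          simp [Fin.ext_iff]
        rw [h]
        exact hsmall ⟨j, hj⟩
      · have h : (univ.filter fun v : Fin n => (cls v : ℕ) = j) = ∅ := by
          ext v
          simp only [mem_filter, mem_univ, true_and, Finset.notMem_empty, iff_false]
          intro h
          exact hj (h ▸ (cls v).is_lt)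
        rw [h, card_empty, Nat.cast_zero]
        positivity
    have h1 : (f (j + 1) : ℝ) = f j + ((univ.filter fun v : Fin n => (cls v : ℕ) = j).card : ℝ) := by
      simp only [hf]
      rw [hsplit, card_union_of_disjoint hdisj, Nat.cast_add]
    linarith
  have hex : ∃ j, (1 / 2 - ε) * (n : ℝ) ≤ f j :=
    ⟨k, by rw [hfk]; nlinarith [hε, (Nat.cast_nonneg n : (0 : ℝ) ≤ n)]⟩
  obtain ⟨j₀, hP, hmin⟩ : ∃ j₀, (1 / 2 - ε) * (n : ℝ) ≤ f j₀ ∧ ∀ j < j₀, ¬ (1 / 2 - ε) * (n : ℝ) ≤ f j :=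
    ⟨Nat.find hex, Nat.find_spec hex, fun j hj => Nat.find_min hex hj⟩
  have hup : (f j₀ : ℝ) ≤ (1 / 2 + ε) * n := by
    rcases Nat.eq_zero_or_pos j₀ with h0 | hpos
    · rw [h0, hf0, Nat.cast_zero]
      positivity
    · have hlt := hmin (j₀ - 1) (by omega)
      push Not at hlt
      have h := hstep (j₀ - 1)
      rw [Nat.sub_add_cancel hpos] at h
      linarith
  refine ⟨univ.filter fun a : Fin k => (a : ℕ) < j₀, ?_⟩
  have hB : (univ.filter fun v : Fin n => cls v ∈ univ.filter fun a : Fin k => (a : ℕ) < j₀) =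
      (univ.filter fun v : Fin n => (cls v : ℕ) < j₀) := by
    ext v
    simp
  rw [hB]
  refine ⟨hP, hup, ?_⟩
  ext i
  simp only [Finset.notMem_empty, iff_false]
  intro hi
  obtain ⟨⟨e, he, hin⟩, ⟨e', he', v, hv, hvout⟩⟩ := mem_splitUnits.1 hi
  apply hvout
  have hmem : cls v ∈ e.map cls := by
    rw [hpar i e he e' he']
    exact Sym2.mem_map.2 ⟨v, hv, rfl⟩
  obtain ⟨u, hu, huv⟩ := Sym2.mem_map.1 hmem
  have hu' := hin u hu
  simp only [mem_filter, mem_univ, true_and] at hu' ⊢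
  rw [huv] at hu'
  exact hu'

/-- **LinearOrZeroW K ε** (verbatim `P4g7.LinearOrZeroW`): more than `K·n` units force a cut in the `ε`-window splitting
no unit. -/
def LinearOrZeroW (K : ℕ) (ε : ℝ) : Prop :=
  ∀ (n m : ℕ) (W : Finset (Sym2 (Fin n))) (π : Fin m → Finset (Sym2 (Fin n))), IsUnitSystem n m W π →
    K * n < m → ∃ B : Finset (Fin n), (1 / 2 - ε) * (n : ℝ) ≤ B.card ∧ (B.card : ℝ) ≤ (1 / 2 + ε) * n ∧
      splitUnits π B = ∅

/-- **ParallelOrLinear K ε** — the DICHOTOMY of BarrierNotesP4g5 §3, typed: every D1 ∧ D2 unit system with more than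
`K·n` units admits a class map `cls : Fin n → Fin k` with all classes of size `≤ 2εn` such that both pairs of every unit
meet the same multiset of classes ("class-parallel": every twin / blow-up / lift design is, with its twin classes).
CAVEAT on the parameters: only the combination `∀ ε > 0, ∃ K, ParallelOrLinear K ε` (as consumed by
`noSpread_of_parallelOrLinear`) is meaningful — for FIXED `K` and `ε < 1/(100·K)` (roughly) the predicate is false for a
trivial reason (the Toft twin system with `L` just above `10K` has `m = L² > K·n` but its twin classes of size 2 already
exceed `2εn`, and singleton classes are never parallel); with `K ≥ 1/ε`, `m > K·n` forces `n > 4K`, hence `2εn > 8`.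
STATUS: the combination itself is REFUTED IN SKETCH (BarrierNotesP4g8 §4: circuit-coupled register designs, `m = N²`,
`n = Θ(N)`, not class-parallel below scale `N + 1` — the pattern half is `not_small_parallel_of_shear`, §5); the predicate
is kept as the typed record of the closed "parallel" route.  The live kill target is `LinearOrZeroW`. -/
def ParallelOrLinear (K : ℕ) (ε : ℝ) : Prop :=
  ∀ (n m : ℕ) (W : Finset (Sym2 (Fin n))) (π : Fin m → Finset (Sym2 (Fin n))), IsUnitSystem n m W π →
    K * n < m → ∃ k : ℕ, ∃ cls : Fin n → Fin k,
      (∀ a : Fin k, ((univ.filter fun v => cls v = a).card : ℝ) ≤ 2 * ε * n) ∧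
      (∀ i, ∀ e ∈ π i, ∀ e' ∈ π i, e.map cls = e'.map cls)

/-- **Dichotomy ⇒ window zero cuts.** -/
theorem linearOrZeroW_of_parallelOrLinear {K : ℕ} {ε : ℝ} (hε : 0 < ε) (h : ParallelOrLinear K ε) :
    LinearOrZeroW K ε := by
  intro n m W π hsys hm
  obtain ⟨k, cls, hsmall, hpar⟩ := h n m W π hsys hm
  obtain ⟨A, h1, h2, h0⟩ := splitUnits_eq_empty_of_parallel_classes ε hε π cls hsmall hpar
  exact ⟨_, h1, h2, h0⟩

/-- **NoSpread** (verbatim `P4g5.NoSpread` / `P4g7.NoSpread`): the engine-level kill target. -/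
def NoSpread : Prop :=
  ∀ ε : ℝ, 0 < ε → ∃ C : ℕ, ∀ᶠ n in Filter.atTop, ∀ (m : ℕ) (W : Finset (Sym2 (Fin n)))
    (π : Fin m → Finset (Sym2 (Fin n))), IsUnitSystem n m W π →
      ∃ B : Finset (Fin n), (1 / 2 - ε) * (n : ℝ) ≤ B.card ∧ (B.card : ℝ) ≤ (1 / 2 + ε) * n ∧
        ((splitUnits π B).card : ℝ) < (n : ℝ) / 2 * Real.logb 2 n + (C : ℝ) * n

theorem one_lt_two_mul_eps {ε : ℝ} (hε : 0 < ε) {N n : ℕ} (hN : 1 / (2 * ε) < N) (hn : N ≤ n) :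
    1 ≤ 2 * ε * n := by
  have hNn : (N : ℝ) ≤ n := by exact_mod_cast hn
  have h2 : 1 / (2 * ε) < n := lt_of_lt_of_le hN hNn
  rw [div_lt_iff₀ (by linarith)] at h2
  linarith

/-- `(∀ ε > 0, ∃ K, LinearOrZeroW K ε) → NoSpread` (verbatim the proof of `P4g7.noSpread_of_linearOrZeroW`). -/
theorem noSpread_of_linearOrZeroW (h : ∀ ε : ℝ, 0 < ε → ∃ K : ℕ, LinearOrZeroW K ε) : NoSpread := by
  intro ε hε
  obtain ⟨K, hK⟩ := h ε hε
  obtain ⟨N, hN⟩ := exists_nat_gt (1 / (2 * ε))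
  refine ⟨K + 1, (Filter.eventually_ge_atTop (max N 1)).mono fun n hn m W π hsys => ?_⟩
  have hn1 : 1 ≤ n := le_of_max_le_right hn
  have hεn : 1 ≤ 2 * ε * n := one_lt_two_mul_eps hε hN (le_of_max_le_left hn)
  have hn0 : (0 : ℝ) < n := by exact_mod_cast hn1
  have hlog : 0 ≤ Real.logb 2 (n : ℝ) := Real.logb_nonneg (by norm_num) (by exact_mod_cast hn1)
  have hpos : (0 : ℝ) ≤ (n : ℝ) / 2 * Real.logb 2 n := by positivity
  by_cases hm : K * n < m
  · obtain ⟨B, hB1, hB2, h0⟩ := hK n m W π hsys hm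
    refine ⟨B, hB1, hB2, ?_⟩
    rw [h0, card_empty, Nat.cast_zero]
    push_cast
    nlinarith
  · push Not at hm
    obtain ⟨B, -, hBcard⟩ := exists_subset_card_eq (s := (univ : Finset (Fin n))) (n := (n + 1) / 2)
      (by rw [card_univ, Fintype.card_fin]; omega)
    have h1 : (n : ℝ) ≤ 2 * (B.card : ℝ) + 1 := by exact_mod_cast (by omega : n ≤ 2 * B.card + 1)
    have h2 : 2 * (B.card : ℝ) ≤ n + 1 := by exact_mod_cast (by omega : 2 * B.card ≤ n + 1)
    refine ⟨B, by nlinarith, by nlinarith, ?_⟩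
    have hsplit : (splitUnits π B).card ≤ m := (card_le_univ _).trans (by rw [Fintype.card_fin])
    have hs : ((splitUnits π B).card : ℝ) ≤ K * n := by exact_mod_cast hsplit.trans hm
    push_cast
    nlinarith

/-- **The parallel route, closed in the kernel:** `(∀ ε > 0, ∃ K, ParallelOrLinear K ε) → NoSpread`.  (Valid; the
hypothesis is refuted in sketch — BarrierNotesP4g8 §4 and `not_small_parallel_of_shear` — so this records a dead route, not
a live target.) -/
theorem noSpread_of_parallelOrLinear (h : ∀ ε : ℝ, 0 < ε → ∃ K : ℕ, ParallelOrLinear K ε) : NoSpread :=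
  noSpread_of_linearOrZeroW fun ε hε => (h ε hε).imp fun _ hK => linearOrZeroW_of_parallelOrLinear hε hK

/-! ## §4  The register lemma: complete bipartite duo patterns force one-hot witnesses

If the FIRST pairs of the units with indices in `X × Y` are exactly the pairs `{x, y}` (a complete bipartite duo pattern, as in
Toft's system), then the D2 witness of unit `(x₀, y₀)` is monochromatic on `{x₀, y₀}` and bichromatic on every other pair of
the pattern, and three colours leave no room: it is ONE-HOT on both registers — constant `β` on `X ∖ {x₀}`, constant `γ` on
`Y ∖ {y₀}`, `c x₀ = c y₀ = α`, with `α, β, γ` distinct.  So on such a pattern the witness carries exactly the information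
"which index is special", and the frame has to transport that information to the second pairs (BarrierNotesP4g8 §3: twins do
it vertex-by-vertex and are class-parallel; any index-MIXING transport is a controlled shifter). -/

theorem fin3_eq_of_ne_ne {p q α γ : Fin 3} (hαγ : α ≠ γ) (hpα : p ≠ α) (hpγ : p ≠ γ) (hqα : q ≠ α) (hqγ : q ≠ γ) :
    p = q := by
  revert p q α γ
  decide

/-- **REGISTER LEMMA (colour level).**  `c` monochromatic on `(x₀, y₀)` and bichromatic on every other pair of `X × Y`,
with second elements `x₁ ∈ X`, `y₁ ∈ Y` available: then `c` is constant on `X ∖ {x₀}` (value `c x₁`), constant on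
`Y ∖ {y₀}` (value `c y₁`), and the three values `c x₀ = c y₀`, `c x₁`, `c y₁` are pairwise distinct. -/
theorem register_oneHot {X Y : Finset (Fin n)} {x₀ x₁ y₀ y₁ : Fin n} (hx₀ : x₀ ∈ X) (hx₁ : x₁ ∈ X) (hx₁₀ : x₁ ≠ x₀)
    (hy₀ : y₀ ∈ Y) (hy₁ : y₁ ∈ Y) (hy₁₀ : y₁ ≠ y₀) {c : Fin n → Fin 3} (hmono : c x₀ = c y₀)
    (hbi : ∀ x ∈ X, ∀ y ∈ Y, (x ≠ x₀ ∨ y ≠ y₀) → c x ≠ c y) :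
    (c x₀ ≠ c x₁ ∧ c x₀ ≠ c y₁ ∧ c x₁ ≠ c y₁) ∧
      (∀ x ∈ X, x ≠ x₀ → c x = c x₁) ∧ (∀ y ∈ Y, y ≠ y₀ → c y = c y₁) := by
  have h10 : c x₁ ≠ c y₀ := hbi x₁ hx₁ y₀ hy₀ (Or.inl hx₁₀)
  have h01 : c x₀ ≠ c y₁ := hbi x₀ hx₀ y₁ hy₁ (Or.inr hy₁₀)
  have h11 : c x₁ ≠ c y₁ := hbi x₁ hx₁ y₁ hy₁ (Or.inl hx₁₀)
  refine ⟨⟨fun h => h10 (h.symm.trans hmono), h01, h11⟩, ?_, ?_⟩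
  · intro x hx hxx₀
    have hxa : c x ≠ c y₀ := hbi x hx y₀ hy₀ (Or.inl hxx₀)
    have hxγ : c x ≠ c y₁ := hbi x hx y₁ hy₁ (Or.inl hxx₀)
    exact fin3_eq_of_ne_ne (α := c y₀) (γ := c y₁) (hmono ▸ h01) hxa hxγ h10 h11
  · intro y hy hyy₀
    have hya : c y ≠ c x₀ := fun h => hbi x₀ hx₀ y hy (Or.inr hyy₀) h.symm
    have hyβ : c y ≠ c x₁ := fun h => hbi x₁ hx₁ y hy (Or.inr hyy₀) h.symm
    exact fin3_eq_of_ne_ne (α := c x₀) (γ := c x₁) (fun h => h10 (h.symm.trans hmono)) hya hyβ h01.symm h11.symm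

/-- **REGISTER LEMMA on the engine hypothesis.**  In a D1 ∧ D2 system, if every pair `{x, y}` (`x ∈ X`, `y ∈ Y`) is a unit
pair, the pair `{x₀, y₀}` belonging to unit `i₀` and every other one to a unit `≠ i₀`, then every D2 witness of `i₀` is one-hot
on the two registers `X`, `Y` (as in `register_oneHot`). -/
theorem witness_oneHot (hsys : IsUnitSystem n m W π) {X Y : Finset (Fin n)} {x₀ x₁ y₀ y₁ : Fin n} (hx₀ : x₀ ∈ X)
    (hx₁ : x₁ ∈ X) (hx₁₀ : x₁ ≠ x₀) (hy₀ : y₀ ∈ Y) (hy₁ : y₁ ∈ Y) (hy₁₀ : y₁ ≠ y₀) {i₀ : Fin m}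
    (h₀ : s(x₀, y₀) ∈ π i₀) (hP : ∀ x ∈ X, ∀ y ∈ Y, (x ≠ x₀ ∨ y ≠ y₀) → ∃ j, j ≠ i₀ ∧ s(x, y) ∈ π j)
    {c : Fin n → Fin 3} (hc : c ∉ killSet (gammaMinus W π i₀)) :
    (c x₀ ≠ c x₁ ∧ c x₀ ≠ c y₁ ∧ c x₁ ≠ c y₁) ∧
      (∀ x ∈ X, x ≠ x₀ → c x = c x₁) ∧ (∀ y ∈ Y, y ≠ y₀ → c y = c y₁) := by
  refine register_oneHot hx₀ hx₁ hx₁₀ hy₀ hy₁ hy₁₀ ((map_mk_isDiag_iff c x₀ y₀).1 (unit_mono_of_witness hsys hc h₀)) ?_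
  intro x hx y hy hne
  obtain ⟨j, hj, hxy⟩ := hP x hx y hy hne
  exact witness_bichromatic hsys hj hc hxy

/-! ## §5  The torus-shear unit pattern is not class-parallel

The unit PATTERN of the circuit-coupled register designs of BarrierNotesP4g8 §4: registers `bx, by_, bx' : Fin N → Fin n`,
units indexed by `Fin N × Fin N`, unit `(x, y) = {s(bx x, by_ y), s(bx' (x + y), by_ y)}` (indices added in `Fin N`, i.e. on
the cyclic group; the memo's `p × q` torus is the same computation componentwise).  ANY class map under which every unit is
parallel identifies `cls (bx x)` with `cls (bx' z)` for EVERY `z`, so (when `bx'` is injective and misses `bx x`) the class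
of `bx x` has at least `N + 1` elements: such a system is class-parallel only at scale `≥ N + 1`, never at scale `2εn` once
`2εn ≤ N`.  (The pattern alone is checked here; that it carries a D1 ∧ D2 frame with `O(N)` auxiliary vertices is the
circuit construction of the memo, NOT formalised.) -/

theorem shear_parallel_identifies {N : ℕ} [NeZero N] (bx by_ bx' : Fin N → Fin n) {k : ℕ} (cls : Fin n → Fin k)
    (hpar : ∀ x y : Fin N, (s(bx x, by_ y)).map cls = (s(bx' (x + y), by_ y)).map cls) (x z : Fin N) :
    cls (bx x) = cls (bx' z) := by
  have h := hpar x (z - x)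
  rw [Sym2.map_mk, Sym2.map_mk, show x + (z - x) = z by rw [add_comm, sub_add_cancel]] at h
  exact Sym2.congr_left.1 h

/-- **The torus-shear pattern forces a class of size `≥ N + 1`.** -/
theorem shear_parallel_big_class {N : ℕ} [NeZero N] (bx by_ bx' : Fin N → Fin n) (hinj : Function.Injective bx')
    (hmiss : ∀ z, bx' z ≠ bx 0) {k : ℕ} (cls : Fin n → Fin k)
    (hpar : ∀ x y : Fin N, (s(bx x, by_ y)).map cls = (s(bx' (x + y), by_ y)).map cls) :
    N + 1 ≤ (univ.filter fun v => cls v = cls (bx 0)).card := by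
  classical
  have hsub : insert (bx 0) (univ.image bx') ⊆ univ.filter fun v => cls v = cls (bx 0) := by
    intro v hv
    rw [mem_insert] at hv
    rw [mem_filter]
    refine ⟨mem_univ _, ?_⟩
    rcases hv with rfl | hv
    · rfl
    · obtain ⟨z, -, rfl⟩ := mem_image.1 hv
      exact (shear_parallel_identifies bx by_ bx' cls hpar 0 z).symm
  have hnot : bx 0 ∉ univ.image bx' := by
    intro h
    obtain ⟨z, -, hz⟩ := mem_image.1 h
    exact hmiss z hz
  calc N + 1 = (insert (bx 0) (univ.image bx')).card := by
        rw [card_insert_of_notMem hnot, card_image_of_injective _ hinj, card_univ, Fintype.card_fin]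
    _ ≤ _ := card_le_card hsub

/-- **No small-scale parallel class map for a torus-shear system.**  If the units with indices `e (x, y)` of a unit family
`π` contain the torus-shear pattern, then every class map making all units of `π` parallel has a class of size `≥ N + 1`;
in particular the conclusion of `ParallelOrLinear K ε` fails for `π` as soon as `2εn < N + 1`. -/
theorem not_small_parallel_of_shear {N : ℕ} [NeZero N] (bx by_ bx' : Fin N → Fin n) (hinj : Function.Injective bx')
    (hmiss : ∀ z, bx' z ≠ bx 0) (e : Fin N × Fin N → Fin m)
    (hunit : ∀ x y, s(bx x, by_ y) ∈ π (e (x, y)) ∧ s(bx' (x + y), by_ y) ∈ π (e (x, y)))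
    {ε : ℝ} (hε : 2 * ε * n < N + 1) :
    ¬ ∃ k : ℕ, ∃ cls : Fin n → Fin k, (∀ a, ((univ.filter fun v => cls v = a).card : ℝ) ≤ 2 * ε * n) ∧
        (∀ i, ∀ e ∈ π i, ∀ e' ∈ π i, e.map cls = e'.map cls) := by
  rintro ⟨k, cls, hsmall, hpar⟩
  have hpar' : ∀ x y : Fin N, (s(bx x, by_ y)).map cls = (s(bx' (x + y), by_ y)).map cls :=
    fun x y => hpar (e (x, y)) _ (hunit x y).1 _ (hunit x y).2
  have hbig := shear_parallel_big_class bx by_ bx' hinj hmiss cls hpar'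
  have h1 := hsmall (cls (bx 0))
  have h2 : ((N + 1 : ℕ) : ℝ) ≤ ((univ.filter fun v => cls v = cls (bx 0)).card : ℝ) := by exact_mod_cast hbig
  push_cast at h2
  linarith

/-! ## §6  The quarter-idle wall: witness colour classes are pair-free up to one unit

A D2 witness `c` of unit `i` is a proper colouring of `Γ − π i ⊇ D − π i`, so each colour class of `c` contains no unit
pair except possibly those of `π i` (`witness_bichromatic`).  Padding a largest colour class of the NON-idle vertices with
the idle ones gives a set of size `≥ |idle| + (n − |idle|)/3` inside which at most ONE unit has a pair; once
`|idle| ≥ n/4` this contains a near-bisection `B` with `|splitUnits π B| ≤ 1`.  This halves the threshold of the idle-half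
wall of p4 g6 (`exists_zeroBisection_of_idle`: `|idle| ≥ n/2`) and is the EQUITABLE-WITNESS wall of BarrierNotesP4g8 §5:
a spread design must keep its auxiliary (pair-free) vertices below a QUARTER of all vertices and every witness colour class
below `(1/2 − ε)n − |idle|`. -/

/-- The IDLE vertices (verbatim `P4g6.idle`): those on no unit pair. -/
def idle (π : Fin m → Finset (Sym2 (Fin n))) : Finset (Fin n) :=
  univ.filter fun v => ∀ i, ∀ e ∈ π i, v ∉ e

theorem mem_idle {v : Fin n} : v ∈ idle π ↔ ∀ i, ∀ e ∈ π i, v ∉ e := by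
  simp [idle]

/-- **Witness classes are pair-free up to one unit.**  If every vertex of `B` is idle or has colour `a` under a D2 witness
`c` of unit `i`, then the only unit that can have a pair inside `B` is `i`; in particular `splitUnits π B ⊆ {i}`. -/
theorem splitUnits_subset_of_class_idle (hsys : IsUnitSystem n m W π) {i : Fin m} {c : Fin n → Fin 3}
    (hc : c ∉ killSet (gammaMinus W π i)) (a : Fin 3) {B : Finset (Fin n)}
    (hB : ∀ v ∈ B, v ∈ idle π ∨ c v = a) : splitUnits π B ⊆ {i} := by
  have key : ∀ j, ∀ e ∈ π j, (∀ v ∈ e, v ∈ B) → j = i := by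
    intro j e he heB
    induction e using Sym2.ind with
    | h u v =>
      have hcu : c u = a := by
        rcases hB u (heB u (Sym2.mem_mk_left u v)) with hu | hu
        · exact absurd (Sym2.mem_mk_left u v) ((mem_idle.1 hu) j _ he)
        · exact hu
      have hcv : c v = a := by
        rcases hB v (heB v (Sym2.mem_mk_right u v)) with hv | hv
        · exact absurd (Sym2.mem_mk_right u v) ((mem_idle.1 hv) j _ he)
        · exact hv
      by_contra hji
      exact witness_bichromatic hsys hji hc he (by rw [hcu, hcv])
  intro j hj
  rw [mem_singleton]
  obtain ⟨⟨e, he, heB⟩, -⟩ := mem_splitUnits.1 hj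
  exact key j e he heB

/-- … hence at most one unit is split by such a `B`. -/
theorem card_splitUnits_le_one_of_class_idle (hsys : IsUnitSystem n m W π) {i : Fin m} {c : Fin n → Fin 3}
    (hc : c ∉ killSet (gammaMinus W π i)) (a : Fin 3) {B : Finset (Fin n)}
    (hB : ∀ v ∈ B, v ∈ idle π ∨ c v = a) : (splitUnits π B).card ≤ 1 :=
  (card_le_card (splitUnits_subset_of_class_idle hsys hc a hB)).trans (card_singleton i).le

/-- **THE QUARTER-IDLE WALL.**  If at least a quarter of the vertices are idle (and there is a unit at all), some exact
near-bisection splits at most one unit. -/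
theorem exists_nearBisection_splitUnits_le_one (hsys : IsUnitSystem n m W π) (hm : 0 < m)
    (hidle : n + 8 ≤ 4 * (idle π).card) :
    ∃ B : Finset (Fin n), n / 2 ≤ B.card ∧ B.card ≤ (n + 1) / 2 ∧ (splitUnits π B).card ≤ 1 := by
  classical
  obtain ⟨cs, hcs⟩ := exists_witnesses hsys
  set i : Fin m := ⟨0, hm⟩
  set c := cs i
  set I := idle π
  set S := univ \ I with hS
  have hScard : S.card = n - I.card := by
    rw [hS, card_sdiff_of_subset (subset_univ _), card_univ, Fintype.card_fin]
  have hIle : I.card ≤ n := (card_le_univ _).trans (by rw [Fintype.card_fin])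
  obtain ⟨a, -, ha⟩ := Finset.exists_le_card_fiber_of_mul_le_card_of_maps_to (f := c) (s := S)
    (t := (univ : Finset (Fin 3))) (n := (n - I.card) / 3) (fun _ _ => mem_univ _) univ_nonempty
    (by rw [card_univ, Fintype.card_fin, hScard]; omega)
  set C := I ∪ S.filter fun v => c v = a with hC
  have hdisj : Disjoint I (S.filter fun v => c v = a) := by
    rw [hS]
    exact disjoint_of_subset_right (filter_subset _ _) disjoint_sdiff
  have hCcard : n / 2 ≤ C.card := by
    rw [hC, card_union_of_disjoint hdisj]
    omega
  obtain ⟨B, hBC, hBcard⟩ := exists_subset_card_eq hCcard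
  refine ⟨B, hBcard.symm.le, by omega, card_splitUnits_le_one_of_class_idle hsys (hcs i) a fun v hv => ?_⟩
  have hvC := hBC hv
  rw [hC, mem_union, mem_filter] at hvC
  rcases hvC with hvI | ⟨-, hva⟩
  · exact Or.inl hvI
  · exact Or.inr hva

/-- **The engine cannot fire when a quarter of the vertices are idle** (`n ≥ 4`, window containing an exact bisection). -/
theorem not_spread_of_quarter_idle (hsys : IsUnitSystem n m W π) (hidle : n + 8 ≤ 4 * (idle π).card)
    {ε : ℝ} {C : ℕ} (hn : 4 ≤ n) (hεn : 1 ≤ 2 * ε * n) :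
    ¬ Spread ε ((n : ℝ) / 2 * Real.logb 2 n + (C : ℝ) * n) π := by
  intro h
  have hn' : (4 : ℝ) ≤ n := by exact_mod_cast hn
  have hlog : (2 : ℝ) ≤ Real.logb 2 n := by
    rw [Real.le_logb_iff_rpow_le (by norm_num) (by linarith)]
    have : (2 : ℝ) ^ (2 : ℝ) = 4 := by
      rw [show (2 : ℝ) = ((2 : ℕ) : ℝ) by norm_num, Real.rpow_natCast]
      norm_num
    rw [this]
    exact hn'
  have hC0 : (0 : ℝ) ≤ (C : ℝ) * n := by positivity
  have hT : (n : ℝ) ≤ (n : ℝ) / 2 * Real.logb 2 n + (C : ℝ) * n := by nlinarith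
  rcases Nat.eq_zero_or_pos m with hm | hm
  · subst hm
    have := demand_le_units_of_spread hεn h
    push_cast at this
    linarith
  obtain ⟨B, hB1, hB2, hsplit⟩ := exists_nearBisection_splitUnits_le_one hsys hm hidle
  have h1 : (n : ℝ) ≤ 2 * (B.card : ℝ) + 1 := by exact_mod_cast (by omega : n ≤ 2 * B.card + 1)
  have h2 : 2 * (B.card : ℝ) ≤ n + 1 := by exact_mod_cast (by omega : 2 * B.card ≤ n + 1)
  obtain ⟨I, hTI, hI⟩ := h B (by nlinarith) (by nlinarith)
  have hIsub : I ⊆ splitUnits π B := fun j hj => mem_splitUnits.2 (hI j hj)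
  have hIcard : (I.card : ℝ) ≤ 1 := by exact_mod_cast (card_le_card hIsub).trans hsplit
  linarith

end Summit.PneNP.PneNP.Cruxes.FoolingMeasure.P4g8
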